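import Literature.NumberTheory.Automorphic.CongruenceSubgroupPropertySL2Lemma4Case2
import HarnessLib

/-!
# Serre's congruence subgroup property for `SL₂(𝓞_F)` — proofs, XI: Vaserstein's Lemma 4

Topic `Literature/NumberTheory/Automorphic`; namespace `Literature.NumberTheory.Automorphic.SL2Rel`.
Everything here is PROVED; no definitions ("Lemma 4 holds for the automorphism `φ` of `SL₂(K)`" —
for every ideal `I ≠ 0` there is an ideal `I'' ≠ 0` with `E(I'', I'') ⊆ φ(E(I, I))` — is spelled out
in each statement).

**Vaserstein 1972, Lemma 4**: *for every `I` and every `g ∈ GL(2, k)` the group `g E(I, I) g⁻¹`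
contains `E(I'', I'')` for some non-zero ideal `I''`.*  Proof (Vaserstein p. 317–318): Case 1, `g`
diagonal — obvious (`lemma4_diagConj`: `I'' = abI` for `g = diag(a/b, 1)`; inner diagonal
automorphisms of `SL₂` are not needed separately); Case 2, `g = (1 1; 0 1)` — the previous file
(`exists_relE_le_conj_e12_one`); Case 3, `g = (1 0; 1 1)` — "совершенно аналогичен случаю 2", here
deduced from Case 2 by conjugating with `w = (0 -1; 1 0)` and `diag(-1, 1)`; general case — `GL₂(k)`
is generated by these, here: every `E₁₂(x)`, `E₂₁(x)`, `x ∈ kˣ`, is a `diag(x, 1)`-conjugate of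
`E₁₂(1)`, `E₂₁(1)`, and `SL₂(k)` is generated by them (Mathlib `SL2.transvection_induction`), the
property being stable under composition (`lemma4_trans`).  Main result:
`SL2Rel.lemma4_conj g` for every `g ∈ SL₂(K)`, `K` a number field with a real place and a unit of
infinite order.

## References

* [Vaserstein1972SL2] L. N. Vaserstein, Mat. Sb. 89 (131) (1972) 313–322, Lemma 4 (pp. 317–318).
* [Liehl1981SL2Orders] B. Liehl, J. reine angew. Math. 323 (1981) 153–171, end of §3.
-/

open Matrix MatrixGroups NumberField

namespace Literature.NumberTheory.Automorphic

namespace SL2Rel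

section Field

variable {R : Type*} [CommRing R] {F : Type*} [Field F] [Algebra R F]

/-! Throughout, "Lemma 4 holds for `φ`" (`φ` an automorphism of `SL₂(F)`) means: for every ideal
`I ≠ 0` of `R` there is an ideal `I'' ≠ 0` with `E(I'', I'') ⊆ φ(E(I, I))` inside `SL₂(F)`
(`F ⊇ R`, typically `F = Frac R`); we spell this out in each statement. -/

/-- Lemma 4 is stable under composition of automorphisms. [cite: Vaserstein1972SL2, Lemma 4 (general case)] -/
theorem lemma4_trans {φ ψ : SL(2, F) ≃* SL(2, F)}
    (hφ : ∀ I : Ideal R, I ≠ ⊥ → ∃ I'' : Ideal R, I'' ≠ ⊥ ∧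
      (relE I'' I'').map (SpecialLinearGroup.map (algebraMap R F)) ≤
        ((relE I I).map (SpecialLinearGroup.map (algebraMap R F))).map φ.toMonoidHom)
    (hψ : ∀ I : Ideal R, I ≠ ⊥ → ∃ I'' : Ideal R, I'' ≠ ⊥ ∧
      (relE I'' I'').map (SpecialLinearGroup.map (algebraMap R F)) ≤
        ((relE I I).map (SpecialLinearGroup.map (algebraMap R F))).map ψ.toMonoidHom) :
    ∀ I : Ideal R, I ≠ ⊥ → ∃ I'' : Ideal R, I'' ≠ ⊥ ∧
      (relE I'' I'').map (SpecialLinearGroup.map (algebraMap R F)) ≤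
        ((relE I I).map (SpecialLinearGroup.map (algebraMap R F))).map (φ.trans ψ).toMonoidHom := by
  intro I hI
  obtain ⟨I₁, hI₁, h₁⟩ := hφ I hI
  obtain ⟨I₂, hI₂, h₂⟩ := hψ I₁ hI₁
  refine ⟨I₂, hI₂, h₂.trans ?_⟩
  rw [show (φ.trans ψ).toMonoidHom = ψ.toMonoidHom.comp φ.toMonoidHom from rfl, ← Subgroup.map_map]
  exact Subgroup.map_mono h₁

/-- Lemma 4 only depends on the underlying map. [folklore] -/
theorem lemma4_congr {φ ψ : SL(2, F) ≃* SL(2, F)}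
    (hφ : ∀ I : Ideal R, I ≠ ⊥ → ∃ I'' : Ideal R, I'' ≠ ⊥ ∧
      (relE I'' I'').map (SpecialLinearGroup.map (algebraMap R F)) ≤
        ((relE I I).map (SpecialLinearGroup.map (algebraMap R F))).map φ.toMonoidHom)
    (h : ∀ M, φ M = ψ M) :
    ∀ I : Ideal R, I ≠ ⊥ → ∃ I'' : Ideal R, I'' ≠ ⊥ ∧
      (relE I'' I'').map (SpecialLinearGroup.map (algebraMap R F)) ≤
        ((relE I I).map (SpecialLinearGroup.map (algebraMap R F))).map ψ.toMonoidHom := by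
  have : φ = ψ := MulEquiv.ext h
  rwa [← this]

/-- **Lemma 4, Case 1** (diagonal `g`): conjugation by `diag(r, 1)`, `r = a/b ∈ Fˣ`, maps `E(I, I)`
onto a group containing `E(abI, abI)`. [cite: Vaserstein1972SL2, Lemma 4 (Case 1)] -/
theorem lemma4_diagConj [IsDomain R] [IsFractionRing R F] (r : Fˣ) :
    ∀ I : Ideal R, I ≠ ⊥ → ∃ I'' : Ideal R, I'' ≠ ⊥ ∧
      (relE I'' I'').map (SpecialLinearGroup.map (algebraMap R F)) ≤
        ((relE I I).map (SpecialLinearGroup.map (algebraMap R F))).map (diagConj r).toMonoidHom := by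
  intro I hI
  obtain ⟨a, b, hb, hab⟩ := IsFractionRing.div_surjective (A := R) (r : F)
  have hb0 : b ≠ 0 := nonZeroDivisors.ne_zero hb
  have hbF : algebraMap R F b ≠ 0 := IsFractionRing.to_map_ne_zero_of_mem_nonZeroDivisors hb
  have ha0 : a ≠ 0 := by
    rintro rfl
    rw [map_zero, zero_div] at hab
    exact r.ne_zero hab.symm
  have haF : algebraMap R F a ≠ 0 := fun h ↦ ha0 (IsFractionRing.injective R F (by rw [h, map_zero]))
  refine ⟨Ideal.span {a * b} * I, ?_, ?_⟩
  · rw [Ne, ← Ideal.zero_eq_bot]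
    refine mul_ne_zero ?_ (by rwa [Ideal.zero_eq_bot])
    rw [Ne, Ideal.zero_eq_bot, Ideal.span_singleton_eq_bot]
    exact mul_ne_zero ha0 hb0
  · rw [map_relE, Subgroup.closure_le]
    rintro _ (⟨x, hx, rfl⟩ | ⟨y, hy, rfl⟩)
    · rw [SetLike.mem_coe] at hx
      obtain ⟨x', hx', rfl⟩ := Ideal.mem_span_singleton_mul.1 hx
      refine Subgroup.mem_map.2 ⟨e12 (algebraMap R F (b * b * x')),
        Subgroup.mem_map.2 ⟨e12 (b * b * x'), e12_mem_relE (I.mul_mem_left _ hx'), map_e12 _ _⟩, ?_⟩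
      rw [MulEquiv.coe_toMonoidHom, diagConj_e12, ← hab]
      congr 1
      rw [map_mul, map_mul, map_mul, map_mul]
      field_simp
    · rw [SetLike.mem_coe] at hy
      obtain ⟨y', hy', rfl⟩ := Ideal.mem_span_singleton_mul.1 hy
      refine Subgroup.mem_map.2 ⟨e21 (algebraMap R F (a * a * y')),
        Subgroup.mem_map.2 ⟨e21 (a * a * y'), e21_mem_relE (I.mul_mem_left _ hy'), map_e21 _ _⟩, ?_⟩
      rw [MulEquiv.coe_toMonoidHom, diagConj_e21]
      congr 1
      have hr : ((r⁻¹ : Fˣ) : F) = algebraMap R F b / algebraMap R F a := by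
        rw [Units.val_inv_eq_inv_val, ← hab, inv_div]
      rw [hr, map_mul, map_mul, map_mul, map_mul]
      field_simp

/-- `w E₁₂(x) w⁻¹ = E₂₁(-x)` for the Weyl element `w = (0 -1; 1 0) = E₁₂(-1)E₂₁(1)E₁₂(-1)`. [folklore] -/
private theorem weyl_conj_e12 (x : F) : (e12 (-1) * e21 1 * e12 (-1) : SL(2, F)) * e12 x * (e12 (-1) * e21 1 * e12 (-1))⁻¹ = e21 (-x) := by
  rw [mul_inv_eq_iff_eq_mul]
  ext i j
  fin_cases i <;> fin_cases j <;> simp [mul_apply_two]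

/-- `w E₂₁(y) w⁻¹ = E₁₂(-y)`. [folklore] -/
private theorem weyl_conj_e21 (y : F) : (e12 (-1) * e21 1 * e12 (-1) : SL(2, F)) * e21 y * (e12 (-1) * e21 1 * e12 (-1))⁻¹ = e12 (-y) := by
  rw [mul_inv_eq_iff_eq_mul]
  ext i j
  fin_cases i <;> fin_cases j <;> simp [mul_apply_two]

/-- `w⁻¹ E₁₂(x) w = E₂₁(-x)`. [folklore] -/
private theorem weyl_inv_conj_e12 (x : F) : (e12 (-1) * e21 1 * e12 (-1) : SL(2, F))⁻¹ * e12 x * (e12 (-1) * e21 1 * e12 (-1)) = e21 (-x) := by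
  have h := weyl_conj_e21 (F := F) (-x)
  rw [neg_neg] at h
  rw [← h]; group

/-- `w⁻¹ E₂₁(y) w = E₁₂(-y)`. [folklore] -/
private theorem weyl_inv_conj_e21 (y : F) : (e12 (-1) * e21 1 * e12 (-1) : SL(2, F))⁻¹ * e21 y * (e12 (-1) * e21 1 * e12 (-1)) = e12 (-y) := by
  have h := weyl_conj_e12 (F := F) (-y)
  rw [neg_neg] at h
  rw [← h]; group

/-- If `φ` maps `E₁₂(x)` to `E₂₁(-x)` and `E₂₁(y)` to `E₁₂(-y)` then `φ(E(I, I)) = E(I, I)`, so Lemma 4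
holds for `φ` with `I'' = I`. [folklore] -/
theorem lemma4_of_swap {φ : SL(2, F) ≃* SL(2, F)} (h12 : ∀ x : F, φ (e12 x) = e21 (-x))
    (h21 : ∀ y : F, φ (e21 y) = e12 (-y)) :
    ∀ I : Ideal R, I ≠ ⊥ → ∃ I'' : Ideal R, I'' ≠ ⊥ ∧
      (relE I'' I'').map (SpecialLinearGroup.map (algebraMap R F)) ≤
        ((relE I I).map (SpecialLinearGroup.map (algebraMap R F))).map φ.toMonoidHom := by
  intro I hI
  refine ⟨I, hI, ?_⟩
  nth_rw 1 [map_relE]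
  rw [Subgroup.closure_le]
  rintro _ (⟨x, hx, rfl⟩ | ⟨y, hy, rfl⟩)
  · rw [SetLike.mem_coe] at hx
    refine Subgroup.mem_map.2 ⟨e21 (algebraMap R F (-x)),
      Subgroup.mem_map.2 ⟨e21 (-x), e21_mem_relE (I.neg_mem hx), map_e21 _ _⟩, ?_⟩
    rw [MulEquiv.coe_toMonoidHom, h21, map_neg, neg_neg]
  · rw [SetLike.mem_coe] at hy
    refine Subgroup.mem_map.2 ⟨e12 (algebraMap R F (-y)),
      Subgroup.mem_map.2 ⟨e12 (-y), e12_mem_relE (I.neg_mem hy), map_e12 _ _⟩, ?_⟩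
    rw [MulEquiv.coe_toMonoidHom, h12, map_neg, neg_neg]

/-- Lemma 4 holds for conjugation by `w`. [folklore] -/
private theorem lemma4_conj_weyl :
    ∀ I : Ideal R, I ≠ ⊥ → ∃ I'' : Ideal R, I'' ≠ ⊥ ∧
      (relE I'' I'').map (SpecialLinearGroup.map (algebraMap R F)) ≤
        ((relE I I).map (SpecialLinearGroup.map (algebraMap R F))).map
          (MulAut.conj (e12 (-1) * e21 1 * e12 (-1) : SL(2, F))).toMonoidHom :=
  lemma4_of_swap (fun x ↦ by rw [MulAut.conj_apply, weyl_conj_e12])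
    (fun y ↦ by rw [MulAut.conj_apply, weyl_conj_e21])

/-- Lemma 4 holds for conjugation by `w⁻¹`. [folklore] -/
private theorem lemma4_conj_weyl_inv :
    ∀ I : Ideal R, I ≠ ⊥ → ∃ I'' : Ideal R, I'' ≠ ⊥ ∧
      (relE I'' I'').map (SpecialLinearGroup.map (algebraMap R F)) ≤
        ((relE I I).map (SpecialLinearGroup.map (algebraMap R F))).map
          (MulAut.conj (e12 (-1) * e21 1 * e12 (-1) : SL(2, F)))⁻¹.toMonoidHom :=
  lemma4_of_swap (fun x ↦ by rw [MulAut.conj_inv_apply, weyl_inv_conj_e12])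
    (fun y ↦ by rw [MulAut.conj_inv_apply, weyl_inv_conj_e21])

/-- Mathlib's transvections in `SL₂` are `E₁₂`, `E₂₁`. [folklore] -/
theorem transvection_eq (i j : Fin 2) (hij : i ≠ j) (c : F) :
    Matrix.SpecialLinearGroup.transvection hij c = e12 c ∨
      Matrix.SpecialLinearGroup.transvection hij c = e21 c := by
  fin_cases i <;> fin_cases j
  · exact absurd rfl hij
  · left
    ext k l
    fin_cases k <;> fin_cases l <;>
      simp [Matrix.SpecialLinearGroup.transvection_coe]
  · right
    ext k l
    fin_cases k <;> fin_cases l <;>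
      simp [Matrix.SpecialLinearGroup.transvection_coe]
  · exact absurd rfl hij

end Field

/-! ### Lemma 4 for every `g ∈ SL₂(K)` -/

section NumberField

variable {K : Type} [Field K] [NumberField K]

/-- **Lemma 4, Case 2, for `E₁₂(x)`, `x ∈ K`**: `E₁₂(x) = diag(x, 1) E₁₂(1) diag(x, 1)⁻¹`.
[cite: Vaserstein1972SL2, Lemma 4 (Case 2)] -/
theorem lemma4_conj_e12 (hreal : ∃ w : InfinitePlace K, w.IsReal)
    (hunit : ∃ v : (𝓞 K)ˣ, ∀ n : ℕ, n ≠ 0 → v ^ n ≠ 1) (x : K) :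
    ∀ I : Ideal (𝓞 K), I ≠ ⊥ → ∃ I'' : Ideal (𝓞 K), I'' ≠ ⊥ ∧
      (relE I'' I'').map (SpecialLinearGroup.map (algebraMap (𝓞 K) K)) ≤
        ((relE I I).map (SpecialLinearGroup.map (algebraMap (𝓞 K) K))).map
          (MulAut.conj (e12 x)).toMonoidHom := by
  by_cases hx : x = 0
  · intro I hI
    refine ⟨I, hI, fun M hM ↦ Subgroup.mem_map.2 ⟨M, hM, ?_⟩⟩
    rw [hx, e12_zero, map_one]; rfl
  · set r : Kˣ := Units.mk0 x hx with hr
    have h2 : ∀ I : Ideal (𝓞 K), I ≠ ⊥ → ∃ I'' : Ideal (𝓞 K), I'' ≠ ⊥ ∧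
        (relE I'' I'').map (SpecialLinearGroup.map (algebraMap (𝓞 K) K)) ≤
          ((relE I I).map (SpecialLinearGroup.map (algebraMap (𝓞 K) K))).map
            (MulAut.conj (e12 (1 : K))).toMonoidHom := fun I hI ↦
      exists_relE_le_conj_e12_one hreal hunit hI
    refine lemma4_congr (lemma4_trans (lemma4_trans (lemma4_diagConj r⁻¹) h2) (lemma4_diagConj r))
      fun M ↦ ?_
    simp only [MulEquiv.trans_apply, MulAut.conj_apply]
    rw [map_mul, map_mul, map_inv, diagConj_e12, mul_one, ← diagConj_symm, MulEquiv.apply_symm_apply,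
      hr, Units.val_mk0]

/-- **Lemma 4, Case 3, for `E₂₁(x)`, `x ∈ K`**: `E₂₁(x) = w E₁₂(-x) w⁻¹`. [cite: Vaserstein1972SL2, Lemma 4 (Case 3)] -/
theorem lemma4_conj_e21 (hreal : ∃ w : InfinitePlace K, w.IsReal)
    (hunit : ∃ v : (𝓞 K)ˣ, ∀ n : ℕ, n ≠ 0 → v ^ n ≠ 1) (x : K) :
    ∀ I : Ideal (𝓞 K), I ≠ ⊥ → ∃ I'' : Ideal (𝓞 K), I'' ≠ ⊥ ∧
      (relE I'' I'').map (SpecialLinearGroup.map (algebraMap (𝓞 K) K)) ≤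
        ((relE I I).map (SpecialLinearGroup.map (algebraMap (𝓞 K) K))).map
          (MulAut.conj (e21 x)).toMonoidHom := by
  have h := lemma4_trans (lemma4_trans (lemma4_conj_weyl_inv (R := 𝓞 K) (F := K))
    (lemma4_conj_e12 hreal hunit (-x))) (lemma4_conj_weyl (R := 𝓞 K))
  refine lemma4_congr h fun M ↦ ?_
  have hw : e21 x = (e12 (-1) * e21 1 * e12 (-1) : SL(2, K)) * e12 (-x) * (e12 (-1) * e21 1 * e12 (-1))⁻¹ := by
    rw [weyl_conj_e12, neg_neg]
  simp only [MulEquiv.trans_apply, MulAut.conj_apply, MulAut.conj_inv_apply]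
  rw [hw]
  group

/-- **Vaserstein 1972, Lemma 4** for `SL₂`: for the ring of integers of a number field `K` with a
real place and a unit of infinite order, every `g ∈ SL₂(K)` and every ideal `I ≠ 0`, the group
`g E(I, I) g⁻¹` contains `E(I'', I'')` for some ideal `I'' ≠ 0`. [cite: Vaserstein1972SL2, Lemma 4] -/
theorem lemma4_conj (hreal : ∃ w : InfinitePlace K, w.IsReal)
    (hunit : ∃ v : (𝓞 K)ˣ, ∀ n : ℕ, n ≠ 0 → v ^ n ≠ 1) (g : SL(2, K)) :
    ∀ I : Ideal (𝓞 K), I ≠ ⊥ → ∃ I'' : Ideal (𝓞 K), I'' ≠ ⊥ ∧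
      (relE I'' I'').map (SpecialLinearGroup.map (algebraMap (𝓞 K) K)) ≤
        ((relE I I).map (SpecialLinearGroup.map (algebraMap (𝓞 K) K))).map
          (MulAut.conj g).toMonoidHom := by
  refine Matrix.SL2.transvection_induction (fun g ↦
    ∀ I : Ideal (𝓞 K), I ≠ ⊥ → ∃ I'' : Ideal (𝓞 K), I'' ≠ ⊥ ∧
      (relE I'' I'').map (SpecialLinearGroup.map (algebraMap (𝓞 K) K)) ≤
        ((relE I I).map (SpecialLinearGroup.map (algebraMap (𝓞 K) K))).map
          (MulAut.conj g).toMonoidHom) ?_ ?_ g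
  · intro i j hij c
    rcases transvection_eq i j hij c with h | h <;> rw [h]
    · exact lemma4_conj_e12 hreal hunit c
    · exact lemma4_conj_e21 hreal hunit c
  · intro A B hA hB
    refine lemma4_congr (lemma4_trans hB hA) fun M ↦ ?_
    rw [MulEquiv.trans_apply, map_mul, MulAut.mul_apply]

/-- Lemma 4 in the form used below: `g E(I'', I'') g⁻¹ ⊆ E(I, I)` for some `I'' ≠ 0`.
[cite: Vaserstein1972SL2, Lemma 4] -/
theorem exists_conj_relE_le (hreal : ∃ w : InfinitePlace K, w.IsReal)
    (hunit : ∃ v : (𝓞 K)ˣ, ∀ n : ℕ, n ≠ 0 → v ^ n ≠ 1) (g : SL(2, K)) {I : Ideal (𝓞 K)}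
    (hI : I ≠ ⊥) : ∃ I'' : Ideal (𝓞 K), I'' ≠ ⊥ ∧
      ∀ M ∈ relE I'' I'', ∃ E ∈ relE I I,
        SpecialLinearGroup.map (algebraMap (𝓞 K) K) E =
          g * SpecialLinearGroup.map (algebraMap (𝓞 K) K) M * g⁻¹ := by
  obtain ⟨I'', hI'', hle⟩ := lemma4_conj hreal hunit g⁻¹ I hI
  refine ⟨I'', hI'', fun M hM ↦ ?_⟩
  obtain ⟨N, hN, hNM⟩ := Subgroup.mem_map.1 (hle (Subgroup.mem_map_of_mem _ hM))
  obtain ⟨E, hE, rfl⟩ := Subgroup.mem_map.1 hN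
  refine ⟨E, hE, ?_⟩
  rw [MulEquiv.coe_toMonoidHom, MulAut.conj_apply, inv_inv] at hNM
  rw [← hNM]
  group

end NumberField

end SL2Rel

end Literature.NumberTheory.Automorphic
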